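import Summits.QuantumFields.YangMills.Theorems.UnitScaleTiltProp7HermiteCornerBlendTorus
import HarnessLib

/-!
# Route `UnitScaleTilt`, crux K1 «MinimiserStabilityRegPr» (stmt-QuantumFields-19200), route-R E′ path (α′), (E1) «pinned slice theorem» — its STARTING POINT (row R2 ∕ (F1′)):
# THE THREE SUP ROWS OF THE FRAMED CORNER BLEND `Φ = Σ_y W_y·R(Fr_y)m_y` — `‖Φ‖ ≤ M`, `‖D_UΦ‖ ≤ (G₁ + 2a₀)·M`, `‖D*_μD_μΦ‖ ≤ (2(a₁ + 2a₀²) + 4a₀G₁ + G₂)·M` per direction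

Cell `ym3-torus`, width seat `ym-ust-19200-w1` (gen 12); LOCATE `LOCATE-F1PRIME-SMOOTH-UNTWIST-w1g12.md` (19200 evidence n = 55, bus 2026-08-28 22:09Z∕22:4xZ).
THEOREMS ONLY (0 `def`, 0 `sorry`); `--supports stmt-QuantumFields-19200`, count-neutral.  YM₃ on T³ is a ladder rung (R3), not the Clay problem; nothing here claims
a stub, the crux, d = 4 or the mass gap.

WHY.  The (E1) contraction (✓ `Prop7ExactCorrectorContractionGauge.exists_unique_exact_corrector_gauge`) needs a starting chart `D‴` with BOTH `Y`-rows k-uniform,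
`ℓ·‖D‴‖_∞ ≤ s‴` AND `ℓ²·‖divB 𝒰 D‴‖_∞ ≤ s₁‴` (plain sups, ✓ `Prop7LinearCorrectorBound.linCorr_gauge_le_of_rows`'s `hq`).  The untwisting gauges of record
(trilinear blends, ✓ `Prop7UntwistChartOfTwist`) give the first row only (cell-face kinks cost a factor `ℓ` in the second), and a biharmonic untwisting has pin cones
(✓ `Prop7InterpErrorNearRow`).  The C¹ CORNER BLEND of LEMMA-H-curved (✓ `Prop7HermiteCornerBlendTorus`: C¹ cardinal weights × (3.35)-framed constants) is C^{1,1} at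
scale `ℓ`; its Laplacian ENERGY was booked there, and THIS FILE books the three POINTWISE rows the smooth untwisting `g := expHerm ∘ Φ` consumes (the second-order row PER
DIRECTION, because the diagonal-BCH partner of ✓ `Prop7PinnedRegaugeChartDiagonal.norm_diagBCH_sub_diagBCH_le` is `D*_μD_μΦ`, not the summed Laplacian).  Nothing needs a
recentring or a coarse-twist input: with `Z := 0`, `c := 0` the rows scale because the weights do (`G₁ = 6∕ℓ`, `G₂ = 24∕ℓ²`).

WHAT IS PROVED (ns `…Theorems.Prop7CornerBlendSupRows`).
* §1 abstract carrier (`S`, `ι`, `T`, `U`, normed `ℝ`-algebra `𝔸 : Type`): `norm_cornerBlend_le` (`‖Φ x‖ ≤ Σ_y W_y(x)‖m_y‖`), ★ `covD_cornerBlend_eq` ∕ `norm_covD_cornerBlend_le_rows`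
  (`‖D_μΦ(x)‖ ≤ 2a₀·Σ_y W_y(x+e_μ)‖m_y‖ + Σ_y|∂⁺_μW_y(x)|·‖m_y‖`), ★★ `covDstar_covD_cornerBlend_eq` ∕ `norm_covDstar_covD_cornerBlend_le_rows` (the per-direction twin of
  ✓ `Prop7HermiteCornerBlendEnergy.norm_lap_cornerBlend_le_rows`, recentred at any `Z`).
* §2 with the mass rows `Σ_y|∂⁺_μW_y| ≤ G₁`, `Σ_y|Δ²_μW_y| ≤ G₂` and a data sup `‖m_y‖ ≤ M`: ★★ `norm_cornerBlend_le_sup`, `norm_covD_cornerBlend_le_sup` (`≤ (G₁ + 2a₀)M`),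
  `norm_covDstar_covD_cornerBlend_le_sup` (`≤ (2(a₁ + 2a₀²) + 4a₀G₁ + G₂)M`).
* §3 the fine torus `Site P 0` with the C¹ cardinal weights (weight rows DISCHARGED as in ✓ `sum_sq_norm_lap_cornerBlend_torus_le`; frame rows `a₀ a₁` displayed on the support
  predicate `∀ ν, y_ν − Q_ν(z) ∈ {−1,0,1,2}`): ★★★ `exists_extension_sup_rows` — an extension `Φ` of the centre data (`Φ ∘ embIter k = m`) that is pointwise a convex
  combination of the framed data and obeys the three sup rows with `G₁ = 6∕ℓ`, `G₂ = 24∕ℓ²`.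
HONEST SCOPE.  Triangle inequalities over landed identities; the frame rows are hypotheses (supplied at the member by ✓ `Prop7LemmaHCurvedFramesOfRegPr.exists_frames_T3_of_regPr`);
nothing of Bałaban's is asserted.

References: T. Bałaban, CMP 99 (1985) 389–434 [Balaban1985BackgroundPropagators] ((3.3)–(3.4) pp.390–391, (3.8) p.392, (3.35) p.396); CMP 95 (1984) 17–40
[Balaban1984PropagatorsI] ((1.29)–(1.31) p.23); CMP 99 (1985) 75–102 [Balaban1985RegularSpaces] ((1.36) p.82, Thm 2 p.83).
-/

set_option autoImplicit false

noncomputable section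

open scoped BigOperators

namespace Summit.QuantumFields.YangMills.Theorems.Prop7CornerBlendSupRows

open Literature.MathematicalPhysics.QuantumFieldTheory.Balaban1983to89
open Finset
open B9Eq39Adjoint (R covD covDstar divB)
open B9Eq310Hermitian (norm_R_le)
open B9TorusCalculus (torusT torusT_apply torusT_symm_apply)
open Summit.QuantumFields.YangMills.Theorems.Prop7ConjFrameTransport (covD_smul_fun covDstar_covD_smul_fun norm_covD_conjFrame_le norm_covDstar_conjFrame_le
  norm_covDstar_covD_conjFrame_le_pair)
open Summit.QuantumFields.YangMills.Theorems.Prop7HermiteCornerBlendCov (covD_finset_sum covDstar_finset_sum sum_secondDiff_weight_eq_zero sum_secondDiff_smul_recenter)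
open Summit.QuantumFields.YangMills.Theorems.Prop7HermiteCardinalWeights (sum_weight_eq_one weight_nonneg)
open Summit.QuantumFields.YangMills.Theorems.Prop7HermiteCornerBlendTorus (weights_vanish_of_far mass_grad_row mass_second_row cornerBlend_embIter)
open B5Eq118OneStroke (iterBlockOf)
open B15DeterminingSets (embIter)

/-! ## §1 The three rows on the abstract carrier -/

section Abstract

variable {𝔸 : Type} [NormedRing 𝔸] [NormedAlgebra ℝ 𝔸] {S : Type*} {ι : Type*} (T : ι → Equiv.Perm S) (U : ι → S → 𝔸ˣ)
  {Y : Type*} [Fintype Y]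

/-- **ZEROTH ORDER**: `‖Σ_y W_y(x)·R(P_y x)m_y‖ ≤ Σ_y W_y(x)·‖m_y‖` for nonnegative weights and bi-contractive frames.
[cite: Balaban1985BackgroundPropagators, (3.35) p.396] -/
theorem norm_cornerBlend_le (W : Y → S → ℝ) (hW0 : ∀ y z, 0 ≤ W y z)
    (P : Y → S → 𝔸ˣ) (hP : ∀ y z, ‖(P y z : 𝔸)‖ ≤ 1 ∧ ‖(((P y z)⁻¹ : 𝔸ˣ) : 𝔸)‖ ≤ 1) (m : Y → 𝔸) (x : S) :
    ‖∑ y, W y x • R (P y x) (m y)‖ ≤ ∑ y, W y x * ‖m y‖ := by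
  refine (norm_sum_le _ _).trans (Finset.sum_le_sum fun y _ => ?_)
  rw [norm_smul, Real.norm_eq_abs, abs_of_nonneg (hW0 y x)]
  exact mul_le_mul_of_nonneg_left (norm_R_le (hP y x).1 (hP y x).2 _) (hW0 y x)

/-- ★ **FIRST ORDER, EXACT**: `D_μ(Σ_y W_y·R(P_y)m_y)(x) = Σ_y [W_y(x+e_μ)·D_μ(R(P_y)m_y)(x) + (W_y(x+e_μ) − W_y(x))·R(P_y x)m_y]`.
[cite: Balaban1985BackgroundPropagators, (3.3) p.390] -/
theorem covD_cornerBlend_eq (W : Y → S → ℝ) (P : Y → S → 𝔸ˣ) (m : Y → 𝔸) (μ : ι) (x : S) :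
    covD T U μ (fun z => ∑ y, W y z • R (P y z) (m y)) x
      = ∑ y, (W y (T μ x) • covD T U μ (fun z => R (P y z) (m y)) x + (W y (T μ x) - W y x) • R (P y x) (m y)) := by
  rw [covD_finset_sum T U Finset.univ (fun y z => W y z • R (P y z) (m y)) μ x]
  exact Finset.sum_congr rfl fun y _ => covD_smul_fun T U (W y) (fun z => R (P y z) (m y)) μ x

/-- ★ **FIRST-ORDER ROW**: with the frame row `‖h_μ(z) − 1‖ ≤ a₀` on the support predicate `N` (off which `W_y` vanishes at `z` and `z ± e_μ`),
`‖D_μΦ(x)‖ ≤ 2a₀·Σ_y W_y(x+e_μ)·‖m_y‖ + Σ_y |W_y(x+e_μ) − W_y(x)|·‖m_y‖`. [cite: Balaban1985BackgroundPropagators, (3.3) p.390, (3.35) p.396] -/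
theorem norm_covD_cornerBlend_le_rows
    (hU : ∀ (κ : ι) (z : S), ‖(U κ z : 𝔸)‖ ≤ 1 ∧ ‖(((U κ z)⁻¹ : 𝔸ˣ) : 𝔸)‖ ≤ 1)
    (W : Y → S → ℝ) (hW0 : ∀ y z, 0 ≤ W y z)
    (P : Y → S → 𝔸ˣ) (hP : ∀ y z, ‖(P y z : 𝔸)‖ ≤ 1 ∧ ‖(((P y z)⁻¹ : 𝔸ˣ) : 𝔸)‖ ≤ 1) (m : Y → 𝔸)
    (N : Y → S → Prop) (hN : ∀ y z, ¬ N y z → W y z = 0 ∧ (∀ μ, W y (T μ z) = 0) ∧ (∀ μ, W y ((T μ).symm z) = 0))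
    (a₀ : ℝ) (hA : ∀ y z, N y z → ∀ μ, ‖(((P y z)⁻¹ * U μ z * P y (T μ z) : 𝔸ˣ) : 𝔸) - 1‖ ≤ a₀) (μ : ι) (x : S) :
    ‖covD T U μ (fun z => ∑ y, W y z • R (P y z) (m y)) x‖
      ≤ 2 * a₀ * ∑ y, W y (T μ x) * ‖m y‖ + ∑ y, |W y (T μ x) - W y x| * ‖m y‖ := by
  rw [covD_cornerBlend_eq T U W P m μ x, Finset.mul_sum, ← Finset.sum_add_distrib]
  refine (norm_sum_le _ _).trans (Finset.sum_le_sum fun y _ => (norm_add_le _ _).trans (add_le_add ?_ ?_))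
  · rw [norm_smul, Real.norm_eq_abs, abs_of_nonneg (hW0 y _)]
    by_cases hn : N y x
    · have h1 := hA y x hn μ
      have b := norm_covD_conjFrame_le T U (hP y) hU (m y) μ x
      have hm := norm_nonneg (m y)
      calc W y (T μ x) * ‖covD T U μ (fun z => R (P y z) (m y)) x‖
          ≤ W y (T μ x) * (2 * a₀ * ‖m y‖) :=
            mul_le_mul_of_nonneg_left (b.trans (mul_le_mul_of_nonneg_right (mul_le_mul_of_nonneg_left h1 (by norm_num)) hm)) (hW0 y _)
        _ = 2 * a₀ * (W y (T μ x) * ‖m y‖) := by ring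
    · rw [(hN y x hn).2.1 μ]; simp
  · rw [norm_smul, Real.norm_eq_abs]
    exact mul_le_mul_of_nonneg_left (norm_R_le (hP y x).1 (hP y x).2 _) (abs_nonneg _)

/-- ★★ **SECOND ORDER IN ONE DIRECTION, EXACT**: with `y′ = x − e_μ`,
`D*_μD_μ(Σ_y W_y·R(P_y)m_y)(x) = Σ_y W_y(x)·D*_μD_μ(R(P_y)m_y)(x) + Σ_y [(∂⁻_μW_y)(x)·D*_μ(R(P_y)m_y)(x) − (∂⁺_μW_y)(x)·D_μ(R(P_y)m_y)(x)] − Σ_y (Δ²_μW_y)(x)·R(P_y x)m_y`.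
[cite: Balaban1985BackgroundPropagators, (3.3) p.390, (3.8) p.392] -/
theorem covDstar_covD_cornerBlend_eq (W : Y → S → ℝ) (P : Y → S → 𝔸ˣ) (m : Y → 𝔸) (μ : ι) (x : S) :
    covDstar T U μ (covD T U μ (fun z => ∑ y, W y z • R (P y z) (m y))) x
      = ∑ y, W y x • covDstar T U μ (covD T U μ (fun z => R (P y z) (m y))) x
        + ∑ y, ((W y x - W y ((T μ).symm x)) • covDstar T U μ (fun z => R (P y z) (m y)) x
            - (W y (T μ x) - W y x) • covD T U μ (fun z => R (P y z) (m y)) x)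
        - ∑ y, ((W y (T μ x) - W y x) - (W y x - W y ((T μ).symm x))) • R (P y x) (m y) := by
  have h1 : covD T U μ (fun z => ∑ y, W y z • R (P y z) (m y)) = fun z => ∑ y, covD T U μ (fun z' => W y z' • R (P y z') (m y)) z := by
    funext z; exact covD_finset_sum T U Finset.univ (fun y z' => W y z' • R (P y z') (m y)) μ z
  rw [h1, covDstar_finset_sum T U Finset.univ (fun y z => covD T U μ (fun z' => W y z' • R (P y z') (m y)) z) μ x,
    Finset.sum_congr rfl (fun y _ => covDstar_covD_smul_fun T U (W y) (fun z => R (P y z) (m y)) μ x),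
    ← Finset.sum_add_distrib, ← Finset.sum_sub_distrib]
  refine Finset.sum_congr rfl fun y _ => ?_
  abel

/-- ★★ **SECOND-ORDER ROW IN ONE DIRECTION** (the per-direction twin of ✓ `Prop7HermiteCornerBlendEnergy.norm_lap_cornerBlend_le_rows`): for weights `W ≥ 0` with
`Σ_y W_y ≡ 1`, bi-contractive frames and background, frame rows `a₀` (holonomy size at `x` and `x − e_μ`) and `a₁` (holonomy backward difference) on the support predicate
`N`, central parts `c_y`, and a data row `‖R(P_y x)m_y − Z‖ ≤ G_y` on `N`:
`‖D*_μD_μΦ(x)‖ ≤ 2(a₁ + 2a₀²)·Σ_y W_y(x)‖m_y − c_y‖ + 2a₀·Σ_y (|∂⁻_μW_y(x)| + |∂⁺_μW_y(x)|)‖m_y − c_y‖ + Σ_y |Δ²_μW_y(x)|·G_y`.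
[cite: Balaban1985BackgroundPropagators, (3.3)-(3.4) pp.390-391, (3.35) p.396] -/
theorem norm_covDstar_covD_cornerBlend_le_rows
    (hU : ∀ (κ : ι) (z : S), ‖(U κ z : 𝔸)‖ ≤ 1 ∧ ‖(((U κ z)⁻¹ : 𝔸ˣ) : 𝔸)‖ ≤ 1)
    (W : Y → S → ℝ) (hW1 : ∀ z : S, ∑ y, W y z = 1) (hW0 : ∀ y z, 0 ≤ W y z)
    (P : Y → S → 𝔸ˣ) (hP : ∀ y z, ‖(P y z : 𝔸)‖ ≤ 1 ∧ ‖(((P y z)⁻¹ : 𝔸ˣ) : 𝔸)‖ ≤ 1)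
    (m c : Y → 𝔸) (hc : ∀ y (a : 𝔸), Commute (c y) a)
    (N : Y → S → Prop) (hN : ∀ y z, ¬ N y z → W y z = 0 ∧ (∀ μ, W y (T μ z) = 0) ∧ (∀ μ, W y ((T μ).symm z) = 0))
    (a₀ a₁ : ℝ)
    (hA : ∀ y z, N y z → ∀ μ, ‖(((P y z)⁻¹ * U μ z * P y (T μ z) : 𝔸ˣ) : 𝔸) - 1‖ ≤ a₀
      ∧ ‖(((P y ((T μ).symm z))⁻¹ * U μ ((T μ).symm z) * P y z : 𝔸ˣ) : 𝔸) - 1‖ ≤ a₀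
      ∧ ‖(((P y z)⁻¹ * U μ z * P y (T μ z) : 𝔸ˣ) : 𝔸) - (((P y ((T μ).symm z))⁻¹ * U μ ((T μ).symm z) * P y z : 𝔸ˣ) : 𝔸)‖ ≤ a₁)
    (μ : ι) (x : S) (Z : 𝔸) (G : Y → ℝ) (hG : ∀ y, N y x → ‖R (P y x) (m y) - Z‖ ≤ G y) :
    ‖covDstar T U μ (covD T U μ (fun z => ∑ y, W y z • R (P y z) (m y))) x‖
      ≤ 2 * (a₁ + 2 * a₀ ^ 2) * ∑ y, W y x * ‖m y - c y‖
        + 2 * a₀ * ∑ y, (|W y x - W y ((T μ).symm x)| + |W y (T μ x) - W y x|) * ‖m y - c y‖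
        + ∑ y, |(W y (T μ x) - W y x) - (W y x - W y ((T μ).symm x))| * G y := by
  rw [covDstar_covD_cornerBlend_eq T U W P m μ x]
  -- recentre the last group at `Z`
  rw [sum_secondDiff_smul_recenter _ (sum_secondDiff_weight_eq_zero W hW1 x (T μ x) ((T μ).symm x)) _ Z]
  refine (norm_sub_le _ _).trans (add_le_add ((norm_add_le _ _).trans (add_le_add ?_ ?_)) ?_)
  · -- group (iii): second-order symmetric-pair row of the framed constants
    rw [Finset.mul_sum]
    refine (norm_sum_le _ _).trans (Finset.sum_le_sum fun y _ => ?_)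
    rw [norm_smul, Real.norm_eq_abs, abs_of_nonneg (hW0 y x)]
    by_cases hn : N y x
    · obtain ⟨h1, h2, h3⟩ := hA y x hn μ
      have b := norm_covDstar_covD_conjFrame_le_pair T U (hP y) hU (m y) (c y) (hc y) μ x
      have s1 := pow_le_pow_left₀ (norm_nonneg _) h1 2
      have s2 := pow_le_pow_left₀ (norm_nonneg _) h2 2
      have b' : ‖covDstar T U μ (covD T U μ (fun z => R (P y z) (m y))) x‖ ≤ 2 * (a₁ + a₀ ^ 2 + a₀ ^ 2) * ‖m y - c y‖ :=
        b.trans (mul_le_mul_of_nonneg_right (mul_le_mul_of_nonneg_left (add_le_add (add_le_add h3 s1) s2) (by norm_num)) (norm_nonneg _))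
      calc W y x * ‖covDstar T U μ (covD T U μ (fun z => R (P y z) (m y))) x‖
          ≤ W y x * (2 * (a₁ + a₀ ^ 2 + a₀ ^ 2) * ‖m y - c y‖) := mul_le_mul_of_nonneg_left b' (hW0 y x)
        _ = 2 * (a₁ + 2 * a₀ ^ 2) * (W y x * ‖m y - c y‖) := by ring
    · rw [(hN y x hn).1]; simp
  · -- group (ii): weight differences times first-order rows
    rw [Finset.mul_sum]
    refine (norm_sum_le _ _).trans (Finset.sum_le_sum fun y _ => ?_)
    by_cases hn : N y x
    · obtain ⟨h1, h2, -⟩ := hA y x hn μ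
      have n3 := norm_nonneg (m y - c y)
      have c1 : ‖covDstar T U μ (fun z => R (P y z) (m y)) x‖ ≤ 2 * a₀ * ‖m y - c y‖ :=
        (Prop7HermiteCornerBlendEnergy.norm_covDstar_conjFrame_le_central T U (hP y) hU (m y) (c y) (hc y) μ x).trans
          (mul_le_mul_of_nonneg_right (mul_le_mul_of_nonneg_left h2 (by norm_num)) n3)
      have c2 : ‖covD T U μ (fun z => R (P y z) (m y)) x‖ ≤ 2 * a₀ * ‖m y - c y‖ :=
        (Prop7HermiteCornerBlendEnergy.norm_covD_conjFrame_le_central T U (hP y) hU (m y) (c y) (hc y) μ x).trans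
          (mul_le_mul_of_nonneg_right (mul_le_mul_of_nonneg_left h1 (by norm_num)) n3)
      calc ‖(W y x - W y ((T μ).symm x)) • covDstar T U μ (fun z => R (P y z) (m y)) x - (W y (T μ x) - W y x) • covD T U μ (fun z => R (P y z) (m y)) x‖
          ≤ |W y x - W y ((T μ).symm x)| * ‖covDstar T U μ (fun z => R (P y z) (m y)) x‖ + |W y (T μ x) - W y x| * ‖covD T U μ (fun z => R (P y z) (m y)) x‖ := by
            refine (norm_sub_le _ _).trans (add_le_add ?_ ?_) <;> rw [norm_smul, Real.norm_eq_abs]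
        _ ≤ |W y x - W y ((T μ).symm x)| * (2 * a₀ * ‖m y - c y‖) + |W y (T μ x) - W y x| * (2 * a₀ * ‖m y - c y‖) :=
            add_le_add (mul_le_mul_of_nonneg_left c1 (abs_nonneg _)) (mul_le_mul_of_nonneg_left c2 (abs_nonneg _))
        _ = 2 * a₀ * ((|W y x - W y ((T μ).symm x)| + |W y (T μ x) - W y x|) * ‖m y - c y‖) := by ring
    · obtain ⟨h0, hp, hm⟩ := hN y x hn
      rw [h0, hp μ, hm μ]; simp
  · -- group (i): weight second differences times the recentred data
    refine (norm_sum_le _ _).trans (Finset.sum_le_sum fun y _ => ?_)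
    rw [norm_smul, Real.norm_eq_abs]
    by_cases hn : N y x
    · exact mul_le_mul_of_nonneg_left (hG y hn) (abs_nonneg _)
    · obtain ⟨h0, hp, hm⟩ := hN y x hn
      rw [h0, hp μ, hm μ]; simp

end Abstract

/-! ## §2 The three SUP rows from the mass rows of the weights -/

section Sup

variable {𝔸 : Type} [NormedRing 𝔸] [NormedAlgebra ℝ 𝔸] {S : Type*} {ι : Type*} (T : ι → Equiv.Perm S) (U : ι → S → 𝔸ˣ)
  {Y : Type*} [Fintype Y]

/-- ★★ **SUP ROW 0**: `‖Φ x‖ ≤ M` for a partition of unity `W ≥ 0`, `Σ_y W_y ≡ 1`, bi-contractive frames and `‖m_y‖ ≤ M`. [cite: Balaban1985BackgroundPropagators, (3.35) p.396] -/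
theorem norm_cornerBlend_le_sup (W : Y → S → ℝ) (hW1 : ∀ z : S, ∑ y, W y z = 1) (hW0 : ∀ y z, 0 ≤ W y z)
    (P : Y → S → 𝔸ˣ) (hP : ∀ y z, ‖(P y z : 𝔸)‖ ≤ 1 ∧ ‖(((P y z)⁻¹ : 𝔸ˣ) : 𝔸)‖ ≤ 1) (m : Y → 𝔸) {M : ℝ} (hm : ∀ y, ‖m y‖ ≤ M) (x : S) :
    ‖∑ y, W y x • R (P y x) (m y)‖ ≤ M := by
  refine (norm_cornerBlend_le W hW0 P hP m x).trans ?_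
  calc ∑ y, W y x * ‖m y‖ ≤ ∑ y, W y x * M := Finset.sum_le_sum fun y _ => mul_le_mul_of_nonneg_left (hm y) (hW0 y x)
    _ = M := by rw [← Finset.sum_mul, hW1, one_mul]

/-- ★★ **SUP ROW 1**: `‖D_μΦ(x)‖ ≤ (G₁ + 2a₀)·M` with the gradient mass row `Σ_y |W_y(z+e_μ) − W_y(z)| ≤ G₁`.
[cite: Balaban1985BackgroundPropagators, (3.3) p.390, (3.35) p.396; Balaban1984PropagatorsI, (1.29)-(1.31) p.23] -/
theorem norm_covD_cornerBlend_le_sup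
    (hU : ∀ (κ : ι) (z : S), ‖(U κ z : 𝔸)‖ ≤ 1 ∧ ‖(((U κ z)⁻¹ : 𝔸ˣ) : 𝔸)‖ ≤ 1)
    (W : Y → S → ℝ) (hW1 : ∀ z : S, ∑ y, W y z = 1) (hW0 : ∀ y z, 0 ≤ W y z)
    (P : Y → S → 𝔸ˣ) (hP : ∀ y z, ‖(P y z : 𝔸)‖ ≤ 1 ∧ ‖(((P y z)⁻¹ : 𝔸ˣ) : 𝔸)‖ ≤ 1) (m : Y → 𝔸) {M : ℝ} (hM : 0 ≤ M) (hm : ∀ y, ‖m y‖ ≤ M)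
    (N : Y → S → Prop) (hN : ∀ y z, ¬ N y z → W y z = 0 ∧ (∀ μ, W y (T μ z) = 0) ∧ (∀ μ, W y ((T μ).symm z) = 0))
    (a₀ : ℝ) (ha₀ : 0 ≤ a₀) (hA : ∀ y z, N y z → ∀ μ, ‖(((P y z)⁻¹ * U μ z * P y (T μ z) : 𝔸ˣ) : 𝔸) - 1‖ ≤ a₀)
    (G₁ : ℝ) (hM1 : ∀ (z : S) (μ : ι), ∑ y, |W y (T μ z) - W y z| ≤ G₁) (μ : ι) (x : S) :
    ‖covD T U μ (fun z => ∑ y, W y z • R (P y z) (m y)) x‖ ≤ (G₁ + 2 * a₀) * M := by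
  refine (norm_covD_cornerBlend_le_rows T U hU W hW0 P hP m N hN a₀ hA μ x).trans ?_
  have e1 : ∑ y, W y (T μ x) * ‖m y‖ ≤ M := by
    calc ∑ y, W y (T μ x) * ‖m y‖ ≤ ∑ y, W y (T μ x) * M := Finset.sum_le_sum fun y _ => mul_le_mul_of_nonneg_left (hm y) (hW0 y _)
      _ = M := by rw [← Finset.sum_mul, hW1, one_mul]
  have e2 : ∑ y, |W y (T μ x) - W y x| * ‖m y‖ ≤ G₁ * M := by
    calc ∑ y, |W y (T μ x) - W y x| * ‖m y‖ ≤ ∑ y, |W y (T μ x) - W y x| * M :=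
          Finset.sum_le_sum fun y _ => mul_le_mul_of_nonneg_left (hm y) (abs_nonneg _)
      _ = (∑ y, |W y (T μ x) - W y x|) * M := by rw [Finset.sum_mul]
      _ ≤ G₁ * M := mul_le_mul_of_nonneg_right (hM1 x μ) hM
  nlinarith [e1, e2, ha₀]

/-- ★★ **SUP ROW 2 (one direction)**: `‖D*_μD_μΦ(x)‖ ≤ (2(a₁ + 2a₀²) + 4a₀G₁ + G₂)·M` with the mass rows `Σ_y|∂⁺_μW_y(z)| ≤ G₁`, `Σ_y|Δ²_μW_y(z)| ≤ G₂` (recentring `Z := 0`,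
central parts `c := 0`). [cite: Balaban1985BackgroundPropagators, (3.3)-(3.4) pp.390-391, (3.8) p.392, (3.35) p.396; Balaban1984PropagatorsI, (1.29)-(1.31) p.23] -/
theorem norm_covDstar_covD_cornerBlend_le_sup
    (hU : ∀ (κ : ι) (z : S), ‖(U κ z : 𝔸)‖ ≤ 1 ∧ ‖(((U κ z)⁻¹ : 𝔸ˣ) : 𝔸)‖ ≤ 1)
    (W : Y → S → ℝ) (hW1 : ∀ z : S, ∑ y, W y z = 1) (hW0 : ∀ y z, 0 ≤ W y z)
    (P : Y → S → 𝔸ˣ) (hP : ∀ y z, ‖(P y z : 𝔸)‖ ≤ 1 ∧ ‖(((P y z)⁻¹ : 𝔸ˣ) : 𝔸)‖ ≤ 1) (m : Y → 𝔸) {M : ℝ} (hM : 0 ≤ M) (hm : ∀ y, ‖m y‖ ≤ M)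
    (N : Y → S → Prop) (hN : ∀ y z, ¬ N y z → W y z = 0 ∧ (∀ μ, W y (T μ z) = 0) ∧ (∀ μ, W y ((T μ).symm z) = 0))
    (a₀ a₁ : ℝ) (ha₀ : 0 ≤ a₀) (ha₁ : 0 ≤ a₁)
    (hA : ∀ y z, N y z → ∀ μ, ‖(((P y z)⁻¹ * U μ z * P y (T μ z) : 𝔸ˣ) : 𝔸) - 1‖ ≤ a₀
      ∧ ‖(((P y ((T μ).symm z))⁻¹ * U μ ((T μ).symm z) * P y z : 𝔸ˣ) : 𝔸) - 1‖ ≤ a₀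
      ∧ ‖(((P y z)⁻¹ * U μ z * P y (T μ z) : 𝔸ˣ) : 𝔸) - (((P y ((T μ).symm z))⁻¹ * U μ ((T μ).symm z) * P y z : 𝔸ˣ) : 𝔸)‖ ≤ a₁)
    (G₁ G₂ : ℝ) (hM1 : ∀ (z : S) (μ : ι), ∑ y, |W y (T μ z) - W y z| ≤ G₁)
    (hM2 : ∀ (z : S) (μ : ι), ∑ y, |(W y (T μ z) - W y z) - (W y z - W y ((T μ).symm z))| ≤ G₂) (μ : ι) (x : S) :
    ‖covDstar T U μ (covD T U μ (fun z => ∑ y, W y z • R (P y z) (m y))) x‖ ≤ (2 * (a₁ + 2 * a₀ ^ 2) + 4 * a₀ * G₁ + G₂) * M := by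
  have h0 : ∀ (y : Y) (a : 𝔸), Commute ((fun _ : Y => (0 : 𝔸)) y) a := fun y a => Commute.zero_left a
  have hG : ∀ y, N y x → ∀ μ' : ι, ‖R (P y x) (m y) - 0‖ ≤ M := fun y _ _ => by
    rw [sub_zero]; exact (norm_R_le (hP y x).1 (hP y x).2 _).trans (hm y)
  have hmain := norm_covDstar_covD_cornerBlend_le_rows T U hU W hW1 hW0 P hP m (fun _ => 0) h0 N hN a₀ a₁ hA μ x 0 (fun _ => M) (fun y hy => hG y hy μ)
  simp only [sub_zero] at hmain
  refine hmain.trans ?_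
  have e1 : ∑ y, W y x * ‖m y‖ ≤ M := by
    calc ∑ y, W y x * ‖m y‖ ≤ ∑ y, W y x * M := Finset.sum_le_sum fun y _ => mul_le_mul_of_nonneg_left (hm y) (hW0 y x)
      _ = M := by rw [← Finset.sum_mul, hW1, one_mul]
  have hb : ∑ y, |W y x - W y ((T μ).symm x)| ≤ G₁ := by
    have := hM1 ((T μ).symm x) μ
    simpa only [Equiv.apply_symm_apply] using this
  have e2 : ∑ y, (|W y x - W y ((T μ).symm x)| + |W y (T μ x) - W y x|) * ‖m y‖ ≤ 2 * G₁ * M := by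
    calc ∑ y, (|W y x - W y ((T μ).symm x)| + |W y (T μ x) - W y x|) * ‖m y‖
        ≤ ∑ y, (|W y x - W y ((T μ).symm x)| + |W y (T μ x) - W y x|) * M :=
          Finset.sum_le_sum fun y _ => mul_le_mul_of_nonneg_left (hm y) (by positivity)
      _ = ((∑ y, |W y x - W y ((T μ).symm x)|) + ∑ y, |W y (T μ x) - W y x|) * M := by rw [← Finset.sum_add_distrib, Finset.sum_mul]
      _ ≤ (G₁ + G₁) * M := mul_le_mul_of_nonneg_right (add_le_add hb (hM1 x μ)) hM
      _ = 2 * G₁ * M := by ring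
  have e3 : ∑ y, |(W y (T μ x) - W y x) - (W y x - W y ((T μ).symm x))| * M ≤ G₂ * M := by
    rw [← Finset.sum_mul]; exact mul_le_mul_of_nonneg_right (hM2 x μ) hM
  have hc : 0 ≤ 2 * (a₁ + 2 * a₀ ^ 2) := by positivity
  have t1 := mul_le_mul_of_nonneg_left e1 hc
  have t2 := mul_le_mul_of_nonneg_left e2 (mul_nonneg (by norm_num : (0:ℝ) ≤ 2) ha₀)
  calc 2 * (a₁ + 2 * a₀ ^ 2) * ∑ y, W y x * ‖m y‖
        + 2 * a₀ * ∑ y, (|W y x - W y ((T μ).symm x)| + |W y (T μ x) - W y x|) * ‖m y‖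
        + ∑ y, |(W y (T μ x) - W y x) - (W y x - W y ((T μ).symm x))| * M
      ≤ 2 * (a₁ + 2 * a₀ ^ 2) * M + 2 * a₀ * (2 * G₁ * M) + G₂ * M := add_le_add (add_le_add t1 t2) e3
    _ = (2 * (a₁ + 2 * a₀ ^ 2) + 4 * a₀ * G₁ + G₂) * M := by ring

end Sup

/-! ## §3 The fine torus: the C¹ cardinal weights discharged, frames displayed -/

section Torus

variable {𝔸 : Type} [NormedRing 𝔸] [NormedAlgebra ℝ 𝔸] {P : Params} {k : ℕ} (hk : k ≤ P.m + P.K) (h : ZMod (P.sitesPerDir 0)) (p : ℕ → ℝ)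

include hk

/-- ★★ **THE THREE SUP ROWS OF THE CORNER BLEND ON THE FINE TORUS** (any offset `h`; weight rows discharged — `G₁ = 6∕ℓ`, `G₂ = 24∕ℓ²`; frame rows `a₀`, `a₁` displayed on
the window `∀ ν, y_ν − Q_ν(z) ∈ {−1,0,1,2}`; data `‖m_y‖ ≤ M`): `‖Φ z‖ ≤ M`, `‖D_μΦ(z)‖ ≤ (6∕ℓ + 2a₀)·M`, `‖D*_μD_μΦ(z)‖ ≤ (2(a₁ + 2a₀²) + 4a₀·(6∕ℓ) + 24∕ℓ²)·M`.
[cite: Balaban1985BackgroundPropagators, (3.3)-(3.4) pp.390-391, (3.8) p.392, (3.35) p.396; Balaban1984PropagatorsI, (1.29)-(1.31) p.23] -/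
theorem cornerBlend_sup_rows_torus (hp0 : p 0 = 1) (hpℓ : p (P.L ^ k) = 0) (hp01 : ∀ r : ℕ, r < P.L ^ k → 0 ≤ p r ∧ p r ≤ 1)
    (hpS : ∀ r : ℕ, r + 1 ≤ P.L ^ k → |p (r + 1) - p r| ≤ 3 / (((P.L ^ k : ℕ) : ℝ)))
    (hpD : ∀ r : ℕ, 1 ≤ r → r + 1 ≤ P.L ^ k → |p (r + 1) - 2 * p r + p (r - 1)| ≤ 6 / (((P.L ^ k : ℕ) : ℝ)) ^ 2)
    (hpc : p 1 + p (P.L ^ k - 1) = 1) (hpk : p (P.L ^ k - 1) ≤ 3 / (((P.L ^ k : ℕ) : ℝ)) ^ 2)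
    (U : Fin P.d → Site P 0 → 𝔸ˣ) (hU : ∀ (κ : Fin P.d) (z : Site P 0), ‖(U κ z : 𝔸)‖ ≤ 1 ∧ ‖(((U κ z)⁻¹ : 𝔸ˣ) : 𝔸)‖ ≤ 1)
    (Fr : Site P k → Site P 0 → 𝔸ˣ) (hFr : ∀ y z, ‖(Fr y z : 𝔸)‖ ≤ 1 ∧ ‖(((Fr y z)⁻¹ : 𝔸ˣ) : 𝔸)‖ ≤ 1)
    (m : Site P k → 𝔸) {M : ℝ} (hM : 0 ≤ M) (hm : ∀ y, ‖m y‖ ≤ M) (a₀ a₁ : ℝ) (ha₀ : 0 ≤ a₀) (ha₁ : 0 ≤ a₁)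
    (hA : ∀ (y : Site P k) (z : Site P 0), (∀ ν : Fin P.d, (y ν = (iterBlockOf k (fun κ => z κ - h)) ν - 1 ∨ y ν = (iterBlockOf k (fun κ => z κ - h)) ν ∨ y ν = (iterBlockOf k (fun κ => z κ - h)) ν + 1 ∨ y ν = (iterBlockOf k (fun κ => z κ - h)) ν + 2)) → ∀ μ : Fin P.d,
      ‖(((Fr y z)⁻¹ * U μ z * Fr y (torusT P 0 μ z) : 𝔸ˣ) : 𝔸) - 1‖ ≤ a₀
      ∧ ‖(((Fr y ((torusT P 0 μ).symm z))⁻¹ * U μ ((torusT P 0 μ).symm z) * Fr y z : 𝔸ˣ) : 𝔸) - 1‖ ≤ a₀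
      ∧ ‖(((Fr y z)⁻¹ * U μ z * Fr y (torusT P 0 μ z) : 𝔸ˣ) : 𝔸)
          - (((Fr y ((torusT P 0 μ).symm z))⁻¹ * U μ ((torusT P 0 μ).symm z) * Fr y z : 𝔸ˣ) : 𝔸)‖ ≤ a₁) :
    (∀ z : Site P 0, ‖∑ y : Site P k, (∏ ν : Fin P.d, (p ((z ν - h).val % P.L ^ k) * (if (iterBlockOf k (fun κ => z κ - h)) ν = y ν then (1 : ℝ) else 0) + (1 - p ((z ν - h).val % P.L ^ k)) * (if (iterBlockOf k (fun κ => z κ - h)) ν + 1 = y ν then (1 : ℝ) else 0))) • R (Fr y z) (m y)‖ ≤ M) ∧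
    (∀ (μ : Fin P.d) (z : Site P 0), ‖covD (torusT P 0) U μ (fun z => ∑ y : Site P k, (∏ ν : Fin P.d, (p ((z ν - h).val % P.L ^ k) * (if (iterBlockOf k (fun κ => z κ - h)) ν = y ν then (1 : ℝ) else 0) + (1 - p ((z ν - h).val % P.L ^ k)) * (if (iterBlockOf k (fun κ => z κ - h)) ν + 1 = y ν then (1 : ℝ) else 0))) • R (Fr y z) (m y)) z‖ ≤ (6 / (((P.L ^ k : ℕ) : ℝ)) + 2 * a₀) * M) ∧
    (∀ (μ : Fin P.d) (z : Site P 0), ‖covDstar (torusT P 0) U μ (covD (torusT P 0) U μ (fun z => ∑ y : Site P k, (∏ ν : Fin P.d, (p ((z ν - h).val % P.L ^ k) * (if (iterBlockOf k (fun κ => z κ - h)) ν = y ν then (1 : ℝ) else 0) + (1 - p ((z ν - h).val % P.L ^ k)) * (if (iterBlockOf k (fun κ => z κ - h)) ν + 1 = y ν then (1 : ℝ) else 0))) • R (Fr y z) (m y))) z‖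
        ≤ (2 * (a₁ + 2 * a₀ ^ 2) + 4 * a₀ * (6 / (((P.L ^ k : ℕ) : ℝ))) + 24 / (((P.L ^ k : ℕ) : ℝ)) ^ 2) * M) := by
  have hW1 : ∀ z : Site P 0, ∑ y : Site P k, (∏ ν : Fin P.d, (p ((z ν - h).val % P.L ^ k) * (if (iterBlockOf k (fun κ => z κ - h)) ν = y ν then (1 : ℝ) else 0) + (1 - p ((z ν - h).val % P.L ^ k)) * (if (iterBlockOf k (fun κ => z κ - h)) ν + 1 = y ν then (1 : ℝ) else 0))) = 1 := fun z => sum_weight_eq_one h p z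
  have hW0 : ∀ (y : Site P k) (z : Site P 0), 0 ≤ (∏ ν : Fin P.d, (p ((z ν - h).val % P.L ^ k) * (if (iterBlockOf k (fun κ => z κ - h)) ν = y ν then (1 : ℝ) else 0) + (1 - p ((z ν - h).val % P.L ^ k)) * (if (iterBlockOf k (fun κ => z κ - h)) ν + 1 = y ν then (1 : ℝ) else 0))) := fun y z => weight_nonneg h p hp01 y z
  have hN : ∀ (y : Site P k) (z : Site P 0), ¬ (∀ ν : Fin P.d, (y ν = (iterBlockOf k (fun κ => z κ - h)) ν - 1 ∨ y ν = (iterBlockOf k (fun κ => z κ - h)) ν ∨ y ν = (iterBlockOf k (fun κ => z κ - h)) ν + 1 ∨ y ν = (iterBlockOf k (fun κ => z κ - h)) ν + 2)) → (∏ ν : Fin P.d, (p ((z ν - h).val % P.L ^ k) * (if (iterBlockOf k (fun κ => z κ - h)) ν = y ν then (1 : ℝ) else 0) + (1 - p ((z ν - h).val % P.L ^ k)) * (if (iterBlockOf k (fun κ => z κ - h)) ν + 1 = y ν then (1 : ℝ) else 0))) = 0 ∧ (∀ μ : Fin P.d, (∏ ν : Fin P.d, (p (((torusT P 0 μ z)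 ν - h).val % P.L ^ k) * (if (iterBlockOf k (fun κ => (torusT P 0 μ z) κ - h)) ν = y ν then (1 : ℝ) else 0) + (1 - p (((torusT P 0 μ z) ν - h).val % P.L ^ k)) * (if (iterBlockOf k (fun κ => (torusT P 0 μ z) κ - h)) ν + 1 = y ν then (1 : ℝ) else 0))) = 0) ∧ (∀ μ : Fin P.d, (∏ ν : Fin P.d, (p ((((torusT P 0 μ).symm z) ν - h).val % P.L ^ k) * (if (iterBlockOf k (fun κ => ((torusT P 0 μ).symm z) κ - h)) ν = y ν then (1 : ℝ) else 0) + (1 - p ((((torusT P 0 μ).symm z) ν - h).val % P.L ^ k)) * (if (iterBlockOf k (fun κ => ((torusT P 0 μ).symm z) κ - h)) ν + 1 = y ν then (1 : ℝ) else 0))) = 0) :=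
    fun y z hfar => weights_vanish_of_far hk h p y z hfar
  have hM1 := mass_grad_row hk h p hp0 hpℓ hp01 hpS
  have hM2 := mass_second_row hk h p hp0 hpℓ hp01 hpD hpc hpk
  have r0 := norm_cornerBlend_le_sup (Y := Site P k) (fun (y : Site P k) (z : Site P 0) => (∏ ν : Fin P.d, (p ((z ν - h).val % P.L ^ k) * (if (iterBlockOf k (fun κ => z κ - h)) ν = y ν then (1 : ℝ) else 0) + (1 - p ((z ν - h).val % P.L ^ k)) * (if (iterBlockOf k (fun κ => z κ - h)) ν + 1 = y ν then (1 : ℝ) else 0)))) hW1 hW0 Fr hFr m hm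
  have r1 := norm_covD_cornerBlend_le_sup (Y := Site P k) (torusT P 0) U hU (fun (y : Site P k) (z : Site P 0) => (∏ ν : Fin P.d, (p ((z ν - h).val % P.L ^ k) * (if (iterBlockOf k (fun κ => z κ - h)) ν = y ν then (1 : ℝ) else 0) + (1 - p ((z ν - h).val % P.L ^ k)) * (if (iterBlockOf k (fun κ => z κ - h)) ν + 1 = y ν then (1 : ℝ) else 0)))) hW1 hW0 Fr hFr m hM hm
    (fun (y : Site P k) (z : Site P 0) => (∀ ν : Fin P.d, (y ν = (iterBlockOf k (fun κ => z κ - h)) ν - 1 ∨ y ν = (iterBlockOf k (fun κ => z κ - h)) ν ∨ y ν = (iterBlockOf k (fun κ => z κ - h)) ν + 1 ∨ y ν = (iterBlockOf k (fun κ => z κ - h)) ν + 2))) hN a₀ ha₀ (fun y z hz μ => (hA y z hz μ).1) _ hM1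
  have r2 := norm_covDstar_covD_cornerBlend_le_sup (Y := Site P k) (torusT P 0) U hU (fun (y : Site P k) (z : Site P 0) => (∏ ν : Fin P.d, (p ((z ν - h).val % P.L ^ k) * (if (iterBlockOf k (fun κ => z κ - h)) ν = y ν then (1 : ℝ) else 0) + (1 - p ((z ν - h).val % P.L ^ k)) * (if (iterBlockOf k (fun κ => z κ - h)) ν + 1 = y ν then (1 : ℝ) else 0)))) hW1 hW0 Fr hFr m hM hm
    (fun (y : Site P k) (z : Site P 0) => (∀ ν : Fin P.d, (y ν = (iterBlockOf k (fun κ => z κ - h)) ν - 1 ∨ y ν = (iterBlockOf k (fun κ => z κ - h)) ν ∨ y ν = (iterBlockOf k (fun κ => z κ - h)) ν + 1 ∨ y ν = (iterBlockOf k (fun κ => z κ - h)) ν + 2))) hN a₀ a₁ ha₀ ha₁ hA _ _ hM1 hM2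
  exact ⟨r0, r1, r2⟩

omit h in
/-- ★★★ **AN EXTENSION OF THE CENTRE DATA WITH THE THREE SUP ROWS** (the corner blend at offset `h = (ℓ−1)∕2`, frames normalised at their centres): there is `Φ` with
`Φ(embIter y) = m_y`, `Φ z` a convex combination of the framed data `R(Fr_y z)m_y` (so Hermitian-traceless data and unitary-type frames give Hermitian-traceless values
downstream), `‖Φ z‖ ≤ M`, `‖D_μΦ(z)‖ ≤ (6∕ℓ + 2a₀)·M` and `‖D*_μD_μΦ(z)‖ ≤ (2(a₁ + 2a₀²) + 4a₀·(6∕ℓ) + 24∕ℓ²)·M` (`ℓ = L^k`).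
[cite: Balaban1985BackgroundPropagators, (3.3)-(3.4) pp.390-391, (3.8) p.392, (3.35) p.396; Balaban1984PropagatorsI, (1.29)-(1.31) p.23] -/
theorem exists_extension_sup_rows (hp0 : p 0 = 1) (hpℓ : p (P.L ^ k) = 0) (hp01 : ∀ r : ℕ, r < P.L ^ k → 0 ≤ p r ∧ p r ≤ 1)
    (hpS : ∀ r : ℕ, r + 1 ≤ P.L ^ k → |p (r + 1) - p r| ≤ 3 / (((P.L ^ k : ℕ) : ℝ)))
    (hpD : ∀ r : ℕ, 1 ≤ r → r + 1 ≤ P.L ^ k → |p (r + 1) - 2 * p r + p (r - 1)| ≤ 6 / (((P.L ^ k : ℕ) : ℝ)) ^ 2)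
    (hpc : p 1 + p (P.L ^ k - 1) = 1) (hpk : p (P.L ^ k - 1) ≤ 3 / (((P.L ^ k : ℕ) : ℝ)) ^ 2)
    (U : Fin P.d → Site P 0 → 𝔸ˣ) (hU : ∀ (κ : Fin P.d) (z : Site P 0), ‖(U κ z : 𝔸)‖ ≤ 1 ∧ ‖(((U κ z)⁻¹ : 𝔸ˣ) : 𝔸)‖ ≤ 1)
    (Fr : Site P k → Site P 0 → 𝔸ˣ) (hFr : ∀ y z, ‖(Fr y z : 𝔸)‖ ≤ 1 ∧ ‖(((Fr y z)⁻¹ : 𝔸ˣ) : 𝔸)‖ ≤ 1) (hFr1 : ∀ y, Fr y (embIter k y) = 1)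
    (m : Site P k → 𝔸) {M : ℝ} (hM : 0 ≤ M) (hm : ∀ y, ‖m y‖ ≤ M) (a₀ a₁ : ℝ) (ha₀ : 0 ≤ a₀) (ha₁ : 0 ≤ a₁)
    (hA : ∀ (y : Site P k) (z : Site P 0), (∀ ν : Fin P.d, (y ν = (iterBlockOf k (fun κ => z κ - ((((P.L ^ k - 1) / 2 : ℕ)) : ZMod (P.sitesPerDir 0)))) ν - 1 ∨ y ν = (iterBlockOf k (fun κ => z κ - ((((P.L ^ k - 1) / 2 : ℕ)) : ZMod (P.sitesPerDir 0)))) ν ∨ y ν = (iterBlockOf k (fun κ => z κ - ((((P.L ^ k - 1) / 2 : ℕ)) : ZMod (P.sitesPerDir 0)))) ν + 1 ∨ y ν = (iterBlockOf k (fun κ => z κ - ((((P.L ^ k - 1) / 2 : ℕ)) : ZMod (P.sitesPerDir 0)))) ν + 2)) → ∀ μ : Fin P.d,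
      ‖(((Fr y z)⁻¹ * U μ z * Fr y (torusT P 0 μ z) : 𝔸ˣ) : 𝔸) - 1‖ ≤ a₀
      ∧ ‖(((Fr y ((torusT P 0 μ).symm z))⁻¹ * U μ ((torusT P 0 μ).symm z) * Fr y z : 𝔸ˣ) : 𝔸) - 1‖ ≤ a₀
      ∧ ‖(((Fr y z)⁻¹ * U μ z * Fr y (torusT P 0 μ z) : 𝔸ˣ) : 𝔸)
          - (((Fr y ((torusT P 0 μ).symm z))⁻¹ * U μ ((torusT P 0 μ).symm z) * Fr y z : 𝔸ˣ) : 𝔸)‖ ≤ a₁) :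
    ∃ Φ : Site P 0 → 𝔸,
      (∀ y : Site P k, Φ (embIter k y) = m y) ∧
      (∀ z : Site P 0, ∃ w : Site P k → ℝ, (∀ y, 0 ≤ w y) ∧ ∑ y, w y = 1 ∧ Φ z = ∑ y, w y • R (Fr y z) (m y)) ∧
      (∀ z : Site P 0, ‖Φ z‖ ≤ M) ∧
      (∀ (μ : Fin P.d) (z : Site P 0), ‖covD (torusT P 0) U μ Φ z‖ ≤ (6 / (((P.L ^ k : ℕ) : ℝ)) + 2 * a₀) * M) ∧
      (∀ (μ : Fin P.d) (z : Site P 0), ‖covDstar (torusT P 0) U μ (covD (torusT P 0) U μ Φ) z‖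
        ≤ (2 * (a₁ + 2 * a₀ ^ 2) + 4 * a₀ * (6 / (((P.L ^ k : ℕ) : ℝ))) + 24 / (((P.L ^ k : ℕ) : ℝ)) ^ 2) * M) := by
  obtain ⟨r0, r1, r2⟩ := cornerBlend_sup_rows_torus hk ((((P.L ^ k - 1) / 2 : ℕ)) : ZMod (P.sitesPerDir 0)) p hp0 hpℓ hp01 hpS hpD hpc hpk U hU Fr hFr m hM hm a₀ a₁ ha₀ ha₁ hA
  exact ⟨fun z => ∑ y : Site P k, (∏ ν : Fin P.d, (p ((z ν - ((((P.L ^ k - 1) / 2 : ℕ)) : ZMod (P.sitesPerDir 0))).val % P.L ^ k) * (if (iterBlockOf k (fun κ => z κ - ((((P.L ^ k - 1) / 2 : ℕ)) : ZMod (P.sitesPerDir 0)))) ν = y ν then (1 : ℝ) else 0) + (1 - p ((z ν - ((((P.L ^ k - 1) / 2 : ℕ)) : ZMod (P.sitesPerDir 0))).val % P.L ^ k)) * (if (iterBlockOf k (fun κ => z κ - ((((P.L ^ k - 1) / 2 : ℕ)) : ZMod (P.sitesPerDir 0)))) ν + 1 = y ν then (1 : ℝ) else 0))) • R (Fr y z)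 (m y), fun y => cornerBlend_embIter hk p hp0 Fr m y (hFr1 y),
    fun z => ⟨fun y => (∏ ν : Fin P.d, (p ((z ν - ((((P.L ^ k - 1) / 2 : ℕ)) : ZMod (P.sitesPerDir 0))).val % P.L ^ k) * (if (iterBlockOf k (fun κ => z κ - ((((P.L ^ k - 1) / 2 : ℕ)) : ZMod (P.sitesPerDir 0)))) ν = y ν then (1 : ℝ) else 0) + (1 - p ((z ν - ((((P.L ^ k - 1) / 2 : ℕ)) : ZMod (P.sitesPerDir 0))).val % P.L ^ k)) * (if (iterBlockOf k (fun κ => z κ - ((((P.L ^ k - 1) / 2 : ℕ)) : ZMod (P.sitesPerDir 0)))) ν + 1 = y ν then (1 : ℝ) else 0))), fun y => weight_nonneg ((((P.L ^ k - 1) / 2 : ℕ)) : ZMod (P.sitesPerDir 0)) p hp01 y z, sum_weight_eq_one ((((P.L ^ k - 1) / 2 : ℕ)) : ZMod (P.sitesPerDir 0)) p z, rfl⟩, r0, r1, r2⟩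

end Torus

end Summit.QuantumFields.YangMills.Theorems.Prop7CornerBlendSupRows

end
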